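import Mathlib
import Literature.Analysis.FluidPDE.VectorCalculus
import Summits.NavierStokesRegularity.NavierStokesRegularity.Theorems.ThreadingFluxErtelTowerStrainShadowClassificationLocal
import HarnessLib

/-!
# Crux `PoloidalLiouville` (stmt-NavierStokesRegularity-1222, W1), crux idea «radial-jerk-tower» (ns-idea-15 g7):
# THE STRAIN SHADOW, V — classification off the principal AXES (gluing across the planes)

Support file (`--supports stmt-NavierStokesRegularity-1222`, helper).  Experiment cell `ns-wall-extremal`, width hand
ns-wall-eng-5 g6, director KEY-NS #186; critic of record ns-wall-crit-1 g4/g5 (V21-P2: «globalisation to a general connected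
`U`: `k` is locally constant on `U ∖ ⋃{xᵢ = 0}`, `τ ≠ 0` on the planes off the axes, continuity of `B` across the planes and
connectedness of `U` glue the octant constants»).  0 kit.

The first half of that globalisation, as a theorem: the conclusion of `StrainShadowClassificationLocal` holds on every
preconnected open `I × U` on which `τ = Sx × x ≠ 0` — `U` may CROSS the principal planes but avoids the principal axes.
Device: the GLOBAL coefficient `k̃ = ⟪B, B⋆⟫/‖B⋆‖²` (smooth wherever `B⋆ ≠ 0`, and `B = k̃·B⋆` there by the frame lemma);
`Dk̃ = 0` at the points off the planes (local classification on a small ball), hence on all of `I × U` by density of those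
points (`dense_offPlanes`: the union of the three planes has empty interior) and continuity of `Dk̃`; so `k̃` is constant on the
preconnected `I × U`.

* `interior_principalPlanes_eq_empty`, `dense_offPlanes`, `shadow_eq_coeff_smul`;
* ★ `strainShadowClassification_offAxes`.

What remains for the sketch's GLOBAL `StrainShadowClassification` (general preconnected `U`): the points of the principal
axes (where `B⋆ = 0`): a punctured-ball-minus-a-line connectivity step at axis points `≠ 0` and the origin.  Not claimed here.

BOOKING (critic's words, V21-P1/P2/P4): a statement about the LINEAR STRAIN SHADOW — not ⟨1222⟩/⟨27585⟩; helper, W1 movement 0;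
refutes nothing.  `PoloidalLiouville` (1222) / (27585) OPEN; NS regularity NOT proved.
-/

-- the summit and its single problem share the name (D-0017 nested layout)
set_option linter.dupNamespace false

noncomputable section

namespace Summit.NavierStokesRegularity.NavierStokesRegularity.Theorems.PoloidalLiouville.ErtelTower

open Set Function Filter Topology Metric
open scoped Topology RealInnerProductSpace InnerProductSpace
open Literature.Analysis.FluidPDE
open Summit.NavierStokesRegularity.NavierStokesRegularity.Theorems.PoloidalLiouville.HorizonTower (E3)

/-! ### The strain shadow off the principal AXES: the coefficient `k̃ = ⟪B, B⋆⟫/‖B⋆‖²` and its constancy -/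

section ShadowOffAxes

variable {ν a b c : ℝ} {B : ℝ → E3 → E3} {I : Set ℝ} {U : Set E3}

/-- The union of the three principal planes has empty interior. -/
theorem interior_principalPlanes_eq_empty :
    interior {x : E3 | x 0 = 0 ∨ x 1 = 0 ∨ x 2 = 0} = ∅ := by
  have hplane : ∀ i : Fin 3, interior {x : E3 | x i = 0} = ∅ := by
    intro i
    refine Set.eq_empty_iff_forall_notMem.mpr fun x hx => ?_
    rw [mem_interior_iff_mem_nhds, Metric.mem_nhds_iff] at hx
    obtain ⟨r, hr, hball⟩ := hx
    have he : ‖EuclideanSpace.single i (1 : ℝ)‖ = 1 := by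
      have h := (EuclideanSpace.basisFun (Fin 3) ℝ).orthonormal.1 i
      rwa [EuclideanSpace.basisFun_apply] at h
    have hmem : x + (r / 2) • EuclideanSpace.single i (1 : ℝ) ∈ Metric.ball x r := by
      rw [Metric.mem_ball, dist_eq_norm, add_sub_cancel_left, norm_smul, he, mul_one, Real.norm_eq_abs,
        abs_of_pos (by positivity)]
      linarith
    have h0 : x i = 0 := hball (Metric.mem_ball_self hr)
    have h1 : (x + (r / 2) • EuclideanSpace.single i (1 : ℝ)) i = 0 := hball hmem
    have h2 : (x + (r / 2) • EuclideanSpace.single i (1 : ℝ)) i = x i + r / 2 := by simp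
    rw [h2, h0, zero_add] at h1
    linarith
  have hclosed : ∀ i : Fin 3, IsClosed {x : E3 | x i = 0} := fun i =>
    isClosed_eq (EuclideanSpace.proj i).continuous continuous_const
  have hset : {x : E3 | x 0 = 0 ∨ x 1 = 0 ∨ x 2 = 0} = {x : E3 | x 0 = 0} ∪ ({x : E3 | x 1 = 0} ∪ {x : E3 | x 2 = 0}) := by
    ext x; simp
  rw [hset, interior_union_isClosed_of_interior_empty (hclosed 0)]
  · exact hplane 0
  · rw [interior_union_isClosed_of_interior_empty (hclosed 1) (hplane 2)]
    exact hplane 1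

/-- Points with all coordinates non-zero are dense. -/
theorem dense_offPlanes : Dense {x : E3 | x 0 ≠ 0 ∧ x 1 ≠ 0 ∧ x 2 ≠ 0} := by
  have h : {x : E3 | x 0 ≠ 0 ∧ x 1 ≠ 0 ∧ x 2 ≠ 0} = {x : E3 | x 0 = 0 ∨ x 1 = 0 ∨ x 2 = 0}ᶜ := by
    ext x; simp [not_or]
  rw [h, ← interior_eq_empty_iff_dense_compl]
  exact interior_principalPlanes_eq_empty

/-- **`B = k̃ · B⋆` wherever `τ ≠ 0`**, with the GLOBAL coefficient `k̃ = ⟪B, B⋆⟫/‖B⋆‖²` — for a field tangent to the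
spheres and to the `S`-ellipsoids. -/
theorem shadow_eq_coeff_smul (htan : ∀ t ∈ I, ∀ x ∈ U, inner ℝ (B t x) x = 0)
    (hS : ∀ t ∈ I, ∀ x ∈ U, inner ℝ (B t x) (strain a b c x) = 0) {t : ℝ} {x : E3} (ht : t ∈ I) (hx : x ∈ U)
    (hτ : topField a b c x ≠ 0) :
    B t x = (inner ℝ (B t x) (Real.exp (quadForm a b c x / (2 * ν)) • topField a b c x)
        / ‖Real.exp (quadForm a b c x / (2 * ν)) • topField a b c x‖ ^ 2)
      • (Real.exp (quadForm a b c x / (2 * ν)) • topField a b c x) := by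
  have hE : Real.exp (quadForm a b c x / (2 * ν)) ≠ 0 := (Real.exp_pos _).ne'
  have hτ2 : ‖topField a b c x‖ ^ 2 ≠ 0 := pow_ne_zero 2 (norm_ne_zero_iff.mpr hτ)
  have h := eq_smul_topField (htan t ht x hx) (hS t ht x hx) hτ
  rw [smul_smul, real_inner_smul_right, norm_smul, mul_pow, Real.norm_eq_abs, sq_abs]
  conv_lhs => rw [h]
  congr 1
  field_simp

/-- **OFF-AXES STRAIN-SHADOW CLASSIFICATION.**  The conclusion of `StrainShadowClassificationLocal` holds on every
preconnected open `I × U` on which `τ = Sx × x` does not vanish (i.e. `U` avoids the principal AXES — it may cross the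
principal planes): the global coefficient `k̃ = ⟪B, B⋆⟫/‖B⋆‖²` is smooth on `I × U`, its derivative vanishes at the points off
the planes (local classification on a ball) hence everywhere (density of such points and continuity of `Dk̃`), so `k̃` is
constant.  (Core of the gluing for the global `StrainShadowClassification`; the axis points remain.) -/
theorem strainShadowClassification_offAxes (ν a b c : ℝ) (B : ℝ → E3 → E3) (I : Set ℝ) (U : Set E3)
    (hν : 0 < ν) (hab : a ≠ b) (hbc : b ≠ c) (hca : c ≠ a) (htr : a + b + c = 0)
    (hI : IsOpen I) (hIc : IsPreconnected I) (hU : IsOpen U) (hUc : IsPreconnected U)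
    (hoff : U ⊆ {x | topField a b c x ≠ 0})
    (hB : ContDiffOn ℝ (⊤ : ℕ∞) (Function.uncurry B) (I ×ˢ U))
    (hdiv : ∀ t ∈ I, ∀ x ∈ U, Literature.Analysis.FluidPDE.VectorCalculus.divergence (B t) x = 0)
    (heq : ∀ t ∈ I, ∀ x ∈ U,
      deriv (fun s => B s x) t + fderiv ℝ (B t) x (strain a b c x) - strain a b c (B t x)
        = ν • Laplacian.laplacian (B t) x)
    (htan : ∀ t ∈ I, ∀ x ∈ U, inner ℝ (B t x) x = 0) :
    ∃ C : ℝ, ∀ t ∈ I, ∀ x ∈ U, B t x = (C * Real.exp (quadForm a b c x / (2 * ν))) • topField a b c x := by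
  set Bs : E3 → E3 := fun y => Real.exp (quadForm a b c y / (2 * ν)) • topField a b c y with hBsdef
  set kt : ℝ × E3 → ℝ := fun q => inner ℝ (Function.uncurry B q) (Bs q.2) / ‖Bs q.2‖ ^ 2 with hktdef
  have hS : ∀ t ∈ I, ∀ x ∈ U, inner ℝ (B t x) (strain a b c x) = 0 :=
    shadow_inner_strain_eq_zero hI hU hB hdiv heq htan
  have hBsne : ∀ x ∈ U, Bs x ≠ 0 := fun x hx =>
    smul_ne_zero (Real.exp_pos _).ne' (hoff hx)
  -- representation `B = k̃ • B⋆` on `I × U`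
  have hrepr : ∀ t ∈ I, ∀ x ∈ U, B t x = kt (t, x) • Bs x := fun t ht x hx =>
    shadow_eq_coeff_smul (ν := ν) htan hS ht hx (hoff hx)
  -- smoothness of `k̃`
  have hopen : IsOpen (I ×ˢ U) := hI.prod hU
  have hkt : ContDiffOn ℝ (⊤ : ℕ∞) kt (I ×ˢ U) := by
    have hBs : ContDiff ℝ (⊤ : ℕ∞) Bs := contDiff_survivor ν a b c
    have hnum : ContDiffOn ℝ (⊤ : ℕ∞) (fun q : ℝ × E3 => inner ℝ (Function.uncurry B q) (Bs q.2)) (I ×ˢ U) :=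
      hB.inner ℝ (hBs.comp contDiff_snd).contDiffOn
    have hden : ContDiffOn ℝ (⊤ : ℕ∞) (fun q : ℝ × E3 => ‖Bs q.2‖ ^ 2) (I ×ˢ U) :=
      ((hBs.comp contDiff_snd).norm_sq ℝ).contDiffOn
    exact hnum.div hden fun q hq => pow_ne_zero 2 (norm_ne_zero_iff.mpr (hBsne q.2 hq.2))
  -- (1) `Dk̃ = 0` at the points off the planes: local classification on a ball
  have hzero_off : ∀ t ∈ I, ∀ x ∈ U, (x 0 ≠ 0 ∧ x 1 ≠ 0 ∧ x 2 ≠ 0) → fderiv ℝ kt (t, x) = 0 := by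
    intro t ht x hx hxoff
    have hW : IsOpen (U ∩ {y : E3 | y 0 ≠ 0 ∧ y 1 ≠ 0 ∧ y 2 ≠ 0}) := by
      refine hU.inter ?_
      have h3 : ∀ i : Fin 3, IsOpen {y : E3 | y i ≠ 0} := fun i => isOpen_ne_fun (EuclideanSpace.proj i).continuous continuous_const
      simpa [Set.setOf_and] using (h3 0).inter ((h3 1).inter (h3 2))
    obtain ⟨r, hr, hball⟩ := Metric.isOpen_iff.mp hW x ⟨hx, hxoff⟩
    have hballU : Metric.ball x r ⊆ U := fun y hy => (hball hy).1
    have hballoff : Metric.ball x r ⊆ {y : E3 | y 0 ≠ 0 ∧ y 1 ≠ 0 ∧ y 2 ≠ 0} := fun y hy => (hball hy).2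
    obtain ⟨C, hC⟩ := strainShadowClassificationLocal ν a b c B I (Metric.ball x r) hν hab hbc hca htr hI hIc Metric.isOpen_ball
      (convex_ball x r).isPreconnected hballoff (hB.mono (Set.prod_mono le_rfl hballU))
      (fun s hs y hy => hdiv s hs y (hballU hy)) (fun s hs y hy => heq s hs y (hballU hy)) (fun s hs y hy => htan s hs y (hballU hy))
    have hev : kt =ᶠ[𝓝 (t, x)] fun _ => C := by
      filter_upwards [(hI.prod Metric.isOpen_ball).mem_nhds (⟨ht, Metric.mem_ball_self hr⟩ : (t, x) ∈ I ×ˢ Metric.ball x r)]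
        with q hq
      obtain ⟨s, y⟩ := q
      have hyU : y ∈ U := hballU hq.2
      have hne : ‖Bs y‖ ^ 2 ≠ 0 := pow_ne_zero 2 (norm_ne_zero_iff.mpr (hBsne y hyU))
      show inner ℝ (B s y) (Bs y) / ‖Bs y‖ ^ 2 = C
      have hCB : (C * Real.exp (quadForm a b c y / (2 * ν))) • topField a b c y = C • Bs y := by rw [← smul_smul]
      rw [hC s hq.1 y hq.2, hCB, real_inner_smul_left, real_inner_self_eq_norm_sq, mul_div_assoc, div_self hne, mul_one]
    rw [hev.fderiv_eq]
    simp
  -- (2) `Dk̃ = 0` everywhere on `I × U`: density + continuity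
  have hcont : ContinuousOn (fderiv ℝ kt) (I ×ˢ U) := hkt.continuousOn_fderiv_of_isOpen hopen (by simp)
  have hzero : (I ×ˢ U).EqOn (fderiv ℝ kt) 0 := by
    rintro ⟨t, x⟩ ⟨ht, hx⟩
    set D : Set (ℝ × E3) := I ×ˢ (U ∩ {y : E3 | y 0 ≠ 0 ∧ y 1 ≠ 0 ∧ y 2 ≠ 0}) with hD
    have hmaps : Set.MapsTo (fderiv ℝ kt) D {0} := by
      rintro ⟨s, y⟩ ⟨hs, hy, hyoff⟩
      exact hzero_off s hs y hy hyoff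
    have hclos : (t, x) ∈ closure D := by
      rw [hD, closure_prod_eq]
      exact ⟨subset_closure ht, dense_offPlanes.open_subset_closure_inter hU hx⟩
    have hDsub : D ⊆ I ×ˢ U := Set.prod_mono le_rfl Set.inter_subset_left
    have hcw : ContinuousWithinAt (fderiv ℝ kt) D (t, x) := (hcont (t, x) ⟨ht, hx⟩).mono hDsub
    have := hcw.mem_closure hclos hmaps
    simpa using this
  -- (3) `k̃` is constant on the preconnected open `I × U`
  obtain ⟨C, hC⟩ := hopen.exists_is_const_of_fderiv_eq_zero (hIc.prod hUc) (hkt.differentiableOn (by simp)) hzero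
  refine ⟨C, fun t ht x hx => ?_⟩
  rw [hrepr t ht x hx, hC (t, x) ⟨ht, hx⟩, smul_smul]

end ShadowOffAxes

end Summit.NavierStokesRegularity.NavierStokesRegularity.Theorems.PoloidalLiouville.ErtelTower
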